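/-
Copyright (c) 2026 the pub-hodgecm-mathlib formalisation cell (harness21).  Prover seat hodgecm-mathlib-K2Liu-p10 (g6), Track B «K2-LIT» ∕ hLiu418
#184♮, Road I v3, unit U5 «THE CLOSE», FACE-G letter L2 (W-orb), closure route (C2) file (C2-iii′) «ORBIT CONTINUITY» (RULING M-158y (2), LEAD
F0P6-plan (g14) 23:42:05Z; desk K2Liu-p09 (g8); box K2E5-r02 (g6)).  THEOREMS ONLY.  2026-09-04.
-/
import Summits.HodgeConjecture.HodgeCM.Model.HypCensus.ArchDatumCoeff                  -- ★ (w1) `continuous_apply_archWeilRep`, `continuous_archProdHom`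
import Summits.HodgeConjecture.HodgeConjecture.Theorems.K2LiuFaceGThetaLetter         -- ★ p863031: `proj_chiSplittingLine_eq_toSp`, `archSkew_diagonal_of_hermD`
import Literature.NumberTheory.Weil1964.ArchDualPairThetaMajorantsRankTwo             -- ★ kind (J3) `nonempty_anyLeviKAKInput_cm_twoTwo`; dictionary, places, CM pin
import Literature.NumberTheory.K2Lit.DoubledFrameThetaMajorants                       -- ★ `dD_signs_twoTwo` (the doubled frame is `U(2,2)` at every place)
import HarnessLib

/-!
# K2_Liu road (hLiu418 = stmt-HodgeConjecture-24832), FACE-G letter L2 (W-orb), route (C2): ORBIT CONTINUITY OF THE SMALL PAIR'S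
# ARCHIMEDEAN WEIL REPRESENTATION — every orbit map `u ↦ ω_∞(u) Ψ` is continuous into `𝓢(X_∞)`

Cell `pub/hodgecm-mathlib` (D-0151), Track B, build stream 29; helper lane (`--supports stmt-HodgeConjecture-24832`), count-neutral.

The (W-orb) closure organ ★ p863244 `K2LiuArchOrbitDerivClosure.thetaOrbitLetter_of_dense` (K2Liu-p09 (g8)) upgrades a derivative law on a dense set of
Schwartz vectors to ALL of `𝓢(X_∞)`, given the STRONG CONTINUITY of the one-parameter orbits
`horb : ∀ Ψ, Continuous (t ↦ ω_∞(exp tX, 1) Ψ)`, `ω_∞ = archWeilRep … (chiSplittingLine …) hs` theta-2's archimedean read-off of the small pair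
`H × U(⟨a′⟩)` (`H = U(diag d_D)`).  THIS FILE pays `horb` — in fact the strong continuity of EVERY orbit map `u ↦ ω_∞(u) Ψ` on the whole archimedean
pair group `H(L⁺ ⊗ ℝ) × U(⟨a′⟩)(L⁺ ⊗ ℝ)` — with NO operator identity for `ω_∞`: it is Folland's «Schur remark» route (w1) of the census kit, ★
`HypCensus.ArchDatumCoeff.continuous_apply_archWeilRep` («operator continuity + Heisenberg covariance over a `KAK` implementer + pointwise coefficient
continuity ⇒ strong continuity»), whose archimedean inputs exist BY NAME at our pin:

* the dictionary ★ `Weil1964.archPhaseMap_toSp_pair`, the place maps ★ `archPairPlace` ∕ `continuous_archPairPlace`, the implementer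
  ★ `kakImplementerData_leviFamily_places_reindex (pairFrame …) I` — verbatim the ingredients of ★ `Weil1964.hasThetaMajorants_omega_pairSplitting` and of
  ★ `ArchDatumPlacesCM.isArchWeilDatum_repTransport_archWeilRep_places_symm`;
* the per-place Levi-form `KAK` KIND for the doubled frame: ★ `Weil1964.nonempty_anyLeviKAKInput_cm_twoTwo` (profile (J3) `U(N−2, 2) × U(1)`, ★
  `LeviKAKInput.junctionTwo`), fed by ★ `K2Lit.DoubledLineTheta.dD_signs_twoTwo` — the doubled frame `d_D` is `U(2,2)` at EVERY real place whatever the signs of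
  `d_V, d_W` (the route by which ★ `K2Lit.hasThetaMajorants_pairRep_dD` discharged socket #42R's `hρ`);
* continuity of the splitting ★ `continuous_chiSplittingLine` + ★ `UnitaryDualPair.continuous_pairSplitting` + ★ `HypCensus.continuous_archProdHom`.

Contents (namespace `…Cruxes.HLiu418.K2LiuArchWeilOrbitContinuous`):
* §1 generic diagonal unitary dual pair over `E/F`: **`continuous_archWeilRep_apply_places`** (explicit sign frames and a `LeviKAKInput` family) and
  **`continuous_archWeilRep_apply_canonical`** (canonical frames, one kind-erased `AnyLeviKAKInput` per place) : `∀ Φ, Continuous fun u => archWeilRep … u Φ`;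
* §2 the CM LINE datum `(U(diag d_V), U(⟨d_W⟩))` at profile `(N−2, 2)`: **`continuous_archWeilRep_apply_line_twoTwo`** (any spelling `T_W = realDiagonal d_W`,
  `subst` device of ★ `Liu2021.hasThetaMajorants_pairRep_line_twoTwo`);
* §3 the K2_Liu doubled frame (`N = 2 + 2`, T5 spelling `T_W a′ ∕ J_W a′ ∕ JW_eq`, `χ := toHeckeCharacter L λ`): **`continuous_archWeilRep_apply_dD`** — every orbit map of
  the `ω_∞` of ★ p863244's `horb` binder is continuous on `H_∞ × U(⟨a′⟩)_∞`, NO hypothesis beyond the socket binders;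
* §4 **`continuous_archWeilRep_dD_expGL`** — p863244's `horb` VERBATIM at `N = 2`, for EVERY `X ∈ 𝔲(J^𝔻)` (no single-place clause): composition with the
  continuous curve `t ↦ (exp tX, 1)` (★ `continuous_expGL_smul`).

Scope note: the tree's `KAK` kinds cover first factors of real rank ≤ 2 (`junction`, `junctionTwo`), so §3–§4 are typed at `N := 2`
(`e : Fin 2 × Fin 1 ≃ Fin n`) — the instance of the FACE-G assembler ★ p863040 and the frame of ★ `hasThetaMajorants_pairRep_dD`.

No definition, no instance, no notation, no named-fact hypothesis, no `sorry`; axioms ⊆ {propext, Classical.choice, Quot.sound}.  HONEST LABEL: HC_CM is proved only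
modulo the 7 printed citations (2 remaining named inputs: hLiu418 = stmt-HodgeConjecture-24832, h413 = stmt-HodgeConjecture-24833) until rung 0 closes; this file is a
`--supports stmt-HodgeConjecture-24832` helper and moves no counter.

References: [Folland1989] G. B. Folland, *Harmonic Analysis in Phase Space* (1989), §4.2, the Schur remark p. 156, (4.24), Prop. (4.39); [Weil1964] A. Weil,
Acta Math. 111 (1964), Chap. III n° 37–39 pp. 188–190; [GelbartRogawski1991] S. Gelbart, J. Rogawski, Invent. Math. 105 (1991) §3.1 Prop. 3.1.1 p. 455;
[KonnoKonno2007] §3.1 (3.1); [Knapp2002] Thm 7.39; [Liu2021] Y. Liu, Camb. J. Math. 9 (2021), App. B, App. D §D.1.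
-/

set_option autoImplicit false
set_option linter.dupNamespace false
-- statements over the adelic dual-pair carriers elaborate to very large types; elaborate sequentially (as in ★ `ArchDualPairL2Continuity`)
set_option Elab.async false

noncomputable section

open NumberField NumberField.InfinitePlace NumberField.mixedEmbedding MeasureTheory IsDedekindDomain
open scoped Matrix Topology SchwartzMap Classical

namespace Summit.HodgeConjecture.HodgeConjecture.Cruxes.HLiu418.K2LiuArchWeilOrbitContinuous

open Literature.NumberTheory.Automorphic Literature.NumberTheory.Automorphic.UnitaryGroup
open Literature.NumberTheory.Automorphic.IdeleClassGroup
open Literature.NumberTheory.Automorphic.Liu2021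
open Literature.NumberTheory.Automorphic.Liu2021.Def411WeilCarriers
open Literature.NumberTheory.Automorphic.Liu2021.Def411WeilCarriersDoubling
open Literature.NumberTheory.GelbartRogawski1991 Literature.NumberTheory.GelbartRogawski1991.UnitaryDualPair
open Literature.NumberTheory.GelbartRogawski1991.GRConstruction
open Literature.NumberTheory.GaloisRepresentations
open Literature.NumberTheory.Weil1964
open Literature.RepresentationTheory.Liu2021
open Literature.RepresentationTheory.HeisenbergGroup
open Literature.RepresentationTheory.KonnoKonno2007 Literature.RepresentationTheory.KonnoKonno2007.RealDualPair
open Literature.Analysis.SegalBargmann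
open Literature.NumberTheory.K2Lit.DoubledLineTheta
open Summit.HodgeConjecture.HodgeConjecture.Cruxes.HLiu418.K2LiuFaceGThetaLetter (proj_chiSplittingLine_eq_toSp archSkew_diagonal_of_hermD)
open HodgeCM.Model.HypCensus (archWeilRep archProdHom continuous_archProdHom continuous_apply_archWeilRep)

/-! ## §1 Generic diagonal unitary dual pair over `E/F`: strong continuity of `archWeilRep` from one `KAK` input per place -/

section Places

variable {F : Type} [Field F] [NumberField F] (E : Type) [Field E] [NumberField E] [Algebra F E] (c : E ≃ₐ[F] E)
  (N M : ℕ) {m : ℕ} (e : Fin N × Fin M ≃ Fin m)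
  (tV : Fin N → F) (tW : Fin M → F) {JV : Matrix (Fin N) (Fin N) E} {JW : Matrix (Fin M) (Fin M) E}
  (hJV : JV = (Matrix.diagonal tV).map (algebraMap F E)) (hJW : JW = (Matrix.diagonal tW).map (algebraMap F E))
  [IsTotallyReal F] [Algebra.IsQuadraticExtension F E] {δ : E} (hcδ : c δ = -δ) (hδ : δ ≠ 0) {d : F}
  (hd : δ * δ = algebraMap F E d) (hV : (Matrix.diagonal tV).IsSymm) (hW : (Matrix.diagonal tW).IsSymm)

section Frames

variable {P Q R S : {v : InfinitePlace F // v.IsReal} → Type*} [∀ v, Fintype (P v)] [∀ v, DecidableEq (P v)]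
  [∀ v, Fintype (Q v)] [∀ v, DecidableEq (Q v)] [∀ v, Fintype (R v)] [∀ v, DecidableEq (R v)]
  [∀ v, Fintype (S v)] [∀ v, DecidableEq (S v)]

/-- **(w1) for the pinned splitting of a diagonal unitary dual pair — STRONG CONTINUITY of `archWeilRep`.**  For `J_V = diag(t_V) ⊗ 1`,
`J_W = diag(t_W) ⊗ 1` (`t_V`, `t_W` nonsingular), per-place sign frames `ε_V, ε_W` with adapted scalings, a family `I v` of Levi-form `KAK` inputs for
Konno–Konno's real pairs `U(P_v,Q_v) × U(R_v,S_v)`, and a CONTINUOUS splitting `s` lying over `toSp`: every orbit map `u ↦ archWeilRep … s hs u Φ` of theta-2's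
archimedean read-off is continuous `U(J_V)(E ⊗ ℝ) × U(J_W)(E ⊗ ℝ) → 𝓢((F ⊗ ℝ)^m)` — ★ `continuous_apply_archWeilRep` over the dictionary ★ `archPhaseMap_toSp_pair`.
[cite: Folland1989, §4.2, the Schur remark p. 156, (4.24), Prop. (4.39)] [cite: Weil1964, Chap. III n° 39 p. 189] [cite: GelbartRogawski1991, §3.1 Prop. 3.1.1 p. 455] -/
theorem continuous_archWeilRep_apply_places (hc : c ≠ 1)
    (wOf : {v : InfinitePlace F // v.IsReal} → {w : InfinitePlace E // w.IsComplex})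
    (hw : ∀ v, c • (wOf v).1 = (wOf v).1) (hover : ∀ v, (wOf v).1.comap (algebraMap F E) = v.1)
    (εV : ∀ v, Fin N ≃ P v ⊕ Q v) (εW : ∀ v, Fin M ≃ R v ⊕ S v)
    {DV : {v : InfinitePlace F // v.IsReal} → Fin N → ℝ} {DW : {v : InfinitePlace F // v.IsReal} → Fin M → ℝ}
    (hDV0 : ∀ v i, DV v i ≠ 0) (hDW0 : ∀ v j, DW v j ≠ 0) {cV cW : {v : InfinitePlace F // v.IsReal} → ℝ}
    (hcV : ∀ v, cV v ≠ 0) (hcW : ∀ v, cW v ≠ 0)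
    (htV : ∀ v i, embedding_of_isReal v.2 (tV i) = cV v * signOf (εV v i) * DV v i ^ 2)
    (htW : ∀ v j, embedding_of_isReal v.2 (tW j) = cW v * signOf (εW v j) * DW v j ^ 2)
    (hcc : ∀ v, cV v * cW v = ((wOf v).1.embedding δ).im)
    (hVd : IsUnit (Matrix.diagonal tV).det) (hWd : IsUnit (Matrix.diagonal tW).det)
    {Kk Pa : {v : InfinitePlace F // v.IsReal} → Type*} [∀ v, TopologicalSpace (Kk v)]
    [∀ v, TopologicalSpace (Pa v)] {κf : ∀ v, Kk v → Ginf (P v) (Q v) (R v) (S v)}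
    {af : ∀ v, Pa v → Ginf (P v) (Q v) (R v) (S v)}
    (I : ∀ v, LeviKAKInput
      (fun g : Ginf (P v) (Q v) (R v) (S v) =>
        (⇑((ι𝕎 (P v) (Q v) (R v) (S v) g).1 :
          ((DPIdx (P v) (Q v) (R v) (S v) → ℝ) × (DPIdx (P v) (Q v) (R v) (S v) → ℝ)) ≃ₗ[ℝ]
            ((DPIdx (P v) (Q v) (R v) (S v) → ℝ) × (DPIdx (P v) (Q v) (R v) (S v) → ℝ))) :
          PhaseMap (DPIdx (P v) (Q v) (R v) (S v))))
      (κf v) (af v))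
    (s : UnitaryGroup.adelicPair F E c N M JV JW →*
      adelicMpCont F (Fin m) (adelicGram F e (Matrix.diagonal tV) (Matrix.diagonal tW)))
    (hs : ∀ g, adelicMpCont.proj F (Fin m) (adelicGram F e (Matrix.diagonal tV) (Matrix.diagonal tW)) (s g) =
      toSp F E c N M e JV JW hcδ hδ hd hV hW hJV hJW g)
    (hsc : Continuous s) (Φ : 𝓢((Fin m → mixedSpace F), ℂ)) :
    Continuous fun u : ↥(UnitaryGroup.arch F E c N JV) × ↥(UnitaryGroup.arch F E c M JW) =>
      archWeilRep F E c N M JV JW hcδ hδ hd hV hW hVd hWd hJV hJW e s hs u Φ :=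
  continuous_apply_archWeilRep F E c N M JV JW hcδ hδ hd hV hW hVd hWd hJV hJW e s hs
    ((continuous_pairSplitting F E c N M e JV JW hsc).comp (continuous_archProdHom F E c N M JV JW))
    (scaledFrame F (Fin m) (pairScale N M (e := e) DV DW) (pairScale_ne_zero N M hDV0 hDW0))
    (isUnit_archMat_of_isUnit _ (isUnit_adelicGram F e hVd hWd))
    (kakImplementerData_leviFamily_places_reindex (fun v => pairFrame (P v) (Q v) (R v) (S v) e (εV v) (εW v)) I)
    (fun u v => archPairPlace E c N M hc wOf hw hover tV tW hJV hJW εV εW hDV0 hDW0 hcV hcW htV htW v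
      (archProdHom F E c N M JV JW u))
    (continuous_pi fun v =>
      (continuous_archPairPlace E c N M hc wOf hw hover tV tW hJV hJW εV εW hDV0 hDW0 hcV hcW htV htW v).comp
        (continuous_archProdHom F E c N M JV JW))
    (fun u pq => congrFun (archPhaseMap_toSp_pair E c N M e hc wOf hw hover tV tW hJV hJW εV εW hDV0 hDW0 hcV hcW htV
      htW hcδ hδ hd hV hW hcc _ (UnitaryGroup.archToAdelic F E c N JV u.1) (UnitaryGroup.archToAdelic F E c M JW u.2)) pq)
    Φ

end Frames

/-- **(w1) in CANONICAL sign frames and scalings** (`signSplit`, `sqrtAbs` of `placeSignVec`; the consumer supplies a nowhere-zero sign convention `c_V` and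
ONE kind-erased Levi-form `KAK` input per place for the resulting real pair, chosen by `Classical.choice`): every orbit map `u ↦ archWeilRep … s hs u Φ` is
continuous. [cite: Folland1989, §4.2, the Schur remark p. 156, (4.24), Prop. (4.39)] [cite: KonnoKonno2007, §3.1 (3.1)] [cite: GelbartRogawski1991, §3.1 Prop. 3.1.1 p. 455] -/
theorem continuous_archWeilRep_apply_canonical (hc : c ≠ 1)
    (wOf : {v : InfinitePlace F // v.IsReal} → {w : InfinitePlace E // w.IsComplex})
    (hw : ∀ v, c • (wOf v).1 = (wOf v).1) (hover : ∀ v, (wOf v).1.comap (algebraMap F E) = v.1)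
    (cV : {v : InfinitePlace F // v.IsReal} → ℝ) (hcV : ∀ v, cV v ≠ 0)
    (hVd : IsUnit (Matrix.diagonal tV).det) (hWd : IsUnit (Matrix.diagonal tW).det)
    (hI : ∀ v, Nonempty (AnyLeviKAKInput (fun g : Ginf
        (PosIdx (placeSignVec tV cV v)) (NegIdx (placeSignVec tV cV v))
        (PosIdx (placeSignVec tW (fun v => ((wOf v).1.embedding δ).im / cV v) v))
        (NegIdx (placeSignVec tW (fun v => ((wOf v).1.embedding δ).im / cV v) v)) =>
      (⇑((ι𝕎 _ _ _ _ g).1 : ((DPIdx _ _ _ _ → ℝ) × (DPIdx _ _ _ _ → ℝ)) ≃ₗ[ℝ] ((DPIdx _ _ _ _ → ℝ) × (DPIdx _ _ _ _ → ℝ))) :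
        PhaseMap (DPIdx
          (PosIdx (placeSignVec tV cV v)) (NegIdx (placeSignVec tV cV v))
          (PosIdx (placeSignVec tW (fun v => ((wOf v).1.embedding δ).im / cV v) v))
          (NegIdx (placeSignVec tW (fun v => ((wOf v).1.embedding δ).im / cV v) v)))))))
    (s : UnitaryGroup.adelicPair F E c N M JV JW →*
      adelicMpCont F (Fin m) (adelicGram F e (Matrix.diagonal tV) (Matrix.diagonal tW)))
    (hs : ∀ g, adelicMpCont.proj F (Fin m) (adelicGram F e (Matrix.diagonal tV) (Matrix.diagonal tW)) (s g) =
      toSp F E c N M e JV JW hcδ hδ hd hV hW hJV hJW g)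
    (hsc : Continuous s) (Φ : 𝓢((Fin m → mixedSpace F), ℂ)) :
    Continuous fun u : ↥(UnitaryGroup.arch F E c N JV) × ↥(UnitaryGroup.arch F E c M JW) =>
      archWeilRep F E c N M JV JW hcδ hδ hd hV hW hVd hWd hJV hJW e s hs u Φ :=
  have hδv : ∀ v : {v : InfinitePlace F // v.IsReal}, ((wOf v).1.embedding δ).im ≠ 0 := fun v =>
    UnitaryGroup.im_embedding_delta_ne_zero F E c (wOf v) (hw v) hc hcδ hδ
  have htV0 : ∀ (v : {v : InfinitePlace F // v.IsReal}) i, embedding_of_isReal v.2 (tV i) ≠ 0 := fun v i =>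
    (map_ne_zero _).2 (ne_zero_of_isUnit_det_diagonal hVd i)
  have htW0 : ∀ (v : {v : InfinitePlace F // v.IsReal}) j, embedding_of_isReal v.2 (tW j) ≠ 0 := fun v j =>
    (map_ne_zero _).2 (ne_zero_of_isUnit_det_diagonal hWd j)
  continuous_archWeilRep_apply_places E c N M e tV tW hJV hJW hcδ hδ hd hV hW hc wOf hw hover
    (fun v => signSplit (placeSignVec tV cV v))
    (fun v => signSplit (placeSignVec tW (fun v => ((wOf v).1.embedding δ).im / cV v) v))
    (DV := fun v => sqrtAbs (placeSignVec tV cV v))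
    (DW := fun v => sqrtAbs (placeSignVec tW (fun v => ((wOf v).1.embedding δ).im / cV v) v))
    (fun v i => sqrtAbs_ne_zero (div_ne_zero (htV0 v i) (hcV v)))
    (fun v j => sqrtAbs_ne_zero (div_ne_zero (htW0 v j) (div_ne_zero (hδv v) (hcV v))))
    (cV := cV) (cW := fun v => ((wOf v).1.embedding δ).im / cV v) hcV
    (fun v => div_ne_zero (hδv v) (hcV v))
    (fun v i => eq_mul_signOf_signSplit_mul_sqrtAbs_sq (hcV v) (fun j => embedding_of_isReal v.2 (tV j)) i (htV0 v i))
    (fun v j => eq_mul_signOf_signSplit_mul_sqrtAbs_sq (div_ne_zero (hδv v) (hcV v))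
      (fun j => embedding_of_isReal v.2 (tW j)) j (htW0 v j))
    (fun v => by rw [← mul_div_assoc, mul_div_cancel_left₀ _ (hcV v)]) hVd hWd
    (fun v => (Classical.choice (hI v)).input) s hs hsc Φ

end Places

/-! ## §2 The CM line datum `(U(diag d_V), U(⟨d_W⟩))`, first factor of signature `(N−2, 2)` at every real place -/

section Line

variable (L : Type) [Field L] [NumberField L] [IsCMField L] {N n' : ℕ} (e₁ : Fin N × Fin 1 ≃ Fin n')
  (dV : Fin N → L) (hdV : ∀ i, IsCMField.complexConj L (dV i) = dV i) (hdV0 : ∀ i, dV i ≠ 0)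

/-- for a LINE `⟨d_W⟩` the sign hypothesis of the `KAK` kind is automatic through every complex embedding. [cite: GelbartRogawski1991, §3.1 Prop. 3.1.1 p. 455] -/
theorem re_apply_line_pos_or_neg (τ : L →+* ℂ) (dW : Fin 1 → L) (hdW : ∀ i, IsCMField.complexConj L (dW i) = dW i)
    (hdW0 : ∀ i, dW i ≠ 0) : (∀ j, 0 < (τ (dW j)).re) ∨ ∀ j, (τ (dW j)).re < 0 :=
  (lt_or_gt_of_ne (re_apply_ne_zero_of_complexConj_eq L τ (hdW 0) (hdW0 0))).symm.imp
    (fun h j => by rwa [Subsingleton.elim j 0]) fun h j => by rwa [Subsingleton.elim j 0]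

/-- **STRONG CONTINUITY of `archWeilRep` for the CM line datum at profile `(N−2, 2)`**: `(U(diag d_V), U(J_W))` over `L/L⁺`, any spelling `T_W` of the line's
real Gram matrix with `T_W = realDiagonal d_W`, any continuous splitting `s` over `toSp`; through every complex embedding `τ` the `re τ(d_V i)` are negative at
two indices `i₀ ≠ i₁`, positive at two named ones `j₀ ≠ j₁` and at every `i ∉ {i₀, i₁}` (the real pair is `U(N−2, 2) × U(1)` at every place — kind ★
`nonempty_anyLeviKAKInput_cm_twoTwo`; the line's own signs are automatic).  Then every orbit map `u ↦ archWeilRep … s hs u Φ` is continuous on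
`U(diag d_V)(L⁺ ⊗ ℝ) × U(J_W)(L⁺ ⊗ ℝ)`. [cite: Folland1989, §4.2, the Schur remark p. 156, (4.24), Prop. (4.39)] [cite: Weil1964, Chap. III n° 39 p. 189]
[cite: GelbartRogawski1991, §3.1 Prop. 3.1.1 p. 455] [cite: KonnoKonno2007, §3.1 (3.1)] -/
theorem continuous_archWeilRep_apply_line_twoTwo (dW : Fin 1 → L) (hdW : ∀ i, IsCMField.complexConj L (dW i) = dW i)
    (hdW0 : ∀ i, dW i ≠ 0) (TW : Matrix (Fin 1) (Fin 1) ↥(maximalRealSubfield L)) (hTW : TW = realDiagonal L dW hdW)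
    (hW : TW.IsSymm) (hWd : IsUnit TW.det) (JW : Matrix (Fin 1) (Fin 1) L)
    (hJW : JW = TW.map (algebraMap (↥(maximalRealSubfield L)) L))
    (s : UnitaryGroup.adelicPair (↥(maximalRealSubfield L)) L (IsCMField.complexConj L) N 1 (Matrix.diagonal dV) JW →*
      adelicMpCont (↥(maximalRealSubfield L)) (Fin n') (adelicGram (↥(maximalRealSubfield L)) e₁ (realDiagonal L dV hdV) TW))
    (hs : ∀ g, adelicMpCont.proj (↥(maximalRealSubfield L)) (Fin n') (adelicGram (↥(maximalRealSubfield L)) e₁ (realDiagonal L dV hdV) TW) (s g) =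
      toSp (↥(maximalRealSubfield L)) L (IsCMField.complexConj L) N 1 e₁ (Matrix.diagonal dV) JW
        (complexConj_imagUnit L) (imagUnit_ne_zero L) (imagUnit_mul_self L) (realDiagonal_isSymm L dV hdV) hW
        (realDiagonal_map L dV hdV).symm hJW g)
    (hsc : Continuous s)
    (h22 : ∀ τ : L →+* ℂ, ∃ i₀ i₁ j₀ j₁ : Fin N, i₀ ≠ i₁ ∧ j₀ ≠ j₁ ∧ (τ (dV i₀)).re < 0 ∧ (τ (dV i₁)).re < 0 ∧
      0 < (τ (dV j₀)).re ∧ 0 < (τ (dV j₁)).re ∧ ∀ i, i ≠ i₀ → i ≠ i₁ → 0 < (τ (dV i)).re)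
    (Φ : 𝓢((Fin n' → mixedSpace ↥(maximalRealSubfield L)), ℂ)) :
    Continuous fun u : ↥(UnitaryGroup.arch (↥(maximalRealSubfield L)) L (IsCMField.complexConj L) N (Matrix.diagonal dV)) ×
        ↥(UnitaryGroup.arch (↥(maximalRealSubfield L)) L (IsCMField.complexConj L) 1 JW) =>
      archWeilRep (↥(maximalRealSubfield L)) L (IsCMField.complexConj L) N 1 (Matrix.diagonal dV) JW
        (complexConj_imagUnit L) (imagUnit_ne_zero L) (imagUnit_mul_self L) (realDiagonal_isSymm L dV hdV) hW
        (isUnit_det_realDiagonal L dV hdV hdV0) hWd (realDiagonal_map L dV hdV).symm hJW e₁ s hs u Φ := by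
  subst hTW
  exact continuous_archWeilRep_apply_canonical L (IsCMField.complexConj L) N 1 e₁ (cmRealVec L dV hdV) (cmRealVec L dW hdW)
    (realDiagonal_map L dV hdV).symm hJW (complexConj_imagUnit L) (imagUnit_ne_zero L) (imagUnit_mul_self L)
    (realDiagonal_isSymm L dV hdV) hW (IsCMField.complexConj_ne_one L) (cmPlaceOver L) (cmPlaceOver_smul L) (cmPlaceOver_comap L)
    (fun _ => (1 : ℝ)) (fun _ => one_ne_zero) (isUnit_det_realDiagonal L dV hdV hdV0) hWd
    (nonempty_anyLeviKAKInput_cm_twoTwo L dV hdV dW hdW h22 fun τ => re_apply_line_pos_or_neg L τ dW hdW hdW0) s hs hsc Φ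

end Line

/-! ## §3 The K2_Liu doubled frame `d_D` (`N = 2 + 2`): every orbit map of the small pair's `ω_∞` is continuous -/

section Doubled

variable (L : Type) [Field L] [NumberField L] [IsCMField L]
variable {n : ℕ} (e : Fin 2 × Fin 1 ≃ Fin n)
  (dV : Fin 2 → L) (hdV : ∀ i, IsCMField.complexConj L (dV i) = dV i)
  (dW : Fin 1 → L) (hdW : ∀ i, IsCMField.complexConj L (dW i) = dW i)
  {n'' : ℕ} (e₁ : Fin (n + n) × Fin 1 ≃ Fin n'')
  (hdV0 : ∀ i, dV i ≠ 0) (hdW0 : ∀ i, dW i ≠ 0)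
  (lam : IdeleClassGroup L →ₜ* Circle) (hlam : IsConjugateSymplectic L lam) (a' : (Fp L)ˣ)

/-- **STRONG CONTINUITY OF THE SMALL PAIR'S `ω_∞` (the representation of ★ p863244's `horb` binder), rank profile `N = 2` of the #42F′ frame**: for the doubled
frame `d_D` of a pair of hermitian planes (`U(2,2) × U(1)` at every real place, ★ `dD_signs_twoTwo` — NO sign hypothesis), the line `⟨a′⟩`, `a′ ∈ (L⁺)ˣ`, and the
`χ`-splitting `chiSplittingLine … (toHeckeCharacter L λ) …` of a conjugate-symplectic `λ`: every orbit map
`u ↦ archWeilRep … (chiSplittingLine …) (proj_chiSplittingLine_eq_toSp …) u Ψ` is continuous `H(L⁺ ⊗ ℝ) × U(⟨a′⟩)(L⁺ ⊗ ℝ) → 𝓢(X_∞)`, for EVERY `Ψ ∈ 𝓢(X_∞)`.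
[cite: Folland1989, §4.2, the Schur remark p. 156, (4.24), Prop. (4.39)] [cite: Weil1964, Chap. III n° 39 p. 189] [cite: Liu2021, App. B; App. D §D.1 Steps 1–2]
[cite: GelbartRogawski1991, §3.1 Prop. 3.1.1 p. 455] -/
theorem continuous_archWeilRep_apply_dD (Ψ : 𝓢((Fin n'' → mixedSpace (Fp L)), ℂ)) :
    Continuous fun u : ↥(UnitaryGroup.arch (Fp L) L (IsCMField.complexConj L) (n + n) (Matrix.diagonal (dD L e dV hdV dW hdW))) ×
        ↥(UnitaryGroup.arch (Fp L) L (IsCMField.complexConj L) 1 (JW (Fp L) L a')) =>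
      archWeilRep (Fp L) L (IsCMField.complexConj L) (n + n) 1 (Matrix.diagonal (dD L e dV hdV dW hdW)) (JW (Fp L) L a')
        (complexConj_imagUnit L) (imagUnit_ne_zero L) (imagUnit_mul_self L)
        (realDiagonal_isSymm L (dD L e dV hdV dW hdW) (dD_conj L e dV hdV dW hdW)) (isSymm_TW (Fp L) a')
        (isUnit_det_realDiagonal L (dD L e dV hdV dW hdW) (dD_conj L e dV hdV dW hdW) (dD_ne_zero L e dV hdV dW hdW hdV0 hdW0))
        (isUnit_det_TW (Fp L) a') (realDiagonal_map L (dD L e dV hdV dW hdW) (dD_conj L e dV hdV dW hdW)).symm (JW_eq (Fp L) L a') e₁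
        (chiSplittingLine L e₁ (dD L e dV hdV dW hdW) (dD_conj L e dV hdV dW hdW) (dD_ne_zero L e dV hdV dW hdW hdV0 hdW0)
          (toHeckeCharacter L lam) (isUnitary_toHeckeCharacter L lam)
          ((isOscillatorChar_toHeckeCharacter_iff lam).mpr hlam) (TW (Fp L) a')
          (isUnit_det_TW (Fp L) a') (JW (Fp L) L a') (JW_eq (Fp L) L a'))
        (proj_chiSplittingLine_eq_toSp L e dV hdV dW hdW e₁ hdV0 hdW0 lam hlam a') u Ψ :=
  continuous_archWeilRep_apply_line_twoTwo L e₁ (dD L e dV hdV dW hdW) (dD_conj L e dV hdV dW hdW)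
    (dD_ne_zero L e dV hdV dW hdW hdV0 hdW0) _ (complexConj_coe_realSubfield L a') (coe_realSubfield_ne_zero L a')
    (TW (Fp L) a') (TW_eq_realDiagonal L a') (isSymm_TW (Fp L) a') (isUnit_det_TW (Fp L) a') (JW (Fp L) L a') (JW_eq (Fp L) L a')
    _ (proj_chiSplittingLine_eq_toSp L e dV hdV dW hdW e₁ hdV0 hdW0 lam hlam a')
    (continuous_chiSplittingLine L e₁ (dD L e dV hdV dW hdW) (dD_conj L e dV hdV dW hdW) (dD_ne_zero L e dV hdV dW hdW hdV0 hdW0)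
      _ _ _ _ _ _ _)
    (dD_signs_twoTwo L e dV hdV hdV0 dW hdW hdW0) Ψ

/-! ## §4 The `horb` letter of ★ p863244 `thetaOrbitLetter_of_dense`, VERBATIM at `N = 2`, for every `X ∈ 𝔲(J^𝔻)` -/

/-- **ORBIT CONTINUITY ALONG THE ARCH ONE-PARAMETER SUBGROUPS** — the `horb` binder of ★ p863244 `K2LiuArchOrbitDerivClosure.thetaOrbitLetter_of_dense`
VERBATIM (rank profile `N = 2`): for EVERY arch letter `X ∈ 𝔲(J^𝔻)` of the #41 frame (no single-place clause) and every `Ψ ∈ 𝓢(X_∞)`,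
`t ↦ ω_∞(exp tX, 1) Ψ` is continuous `ℝ → 𝓢(X_∞)` (§3 composed with the continuous curve `t ↦ (exp tX, 1)`, ★ `continuous_expGL_smul`).
[cite: Folland1989, §4.2, the Schur remark p. 156] [cite: Weil1964, Chap. III n° 39 p. 189] [cite: BorelJacquet1979, §4.1] -/
theorem continuous_archWeilRep_dD_expGL {X : Matrix (Fin (n + n)) (Fin (n + n)) (mixedSpace L)}
    (hX : X ∈ archSkew (Fp L) L (IsCMField.complexConj L) (n + n) (hermD L e dV hdV dW hdW))
    (Ψ : 𝓢((Fin n'' → mixedSpace (Fp L)), ℂ)) :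
    Continuous fun t : ℝ =>
      (archWeilRep (Fp L) L (IsCMField.complexConj L) (n + n) 1 (Matrix.diagonal (dD L e dV hdV dW hdW)) (JW (Fp L) L a')
          (complexConj_imagUnit L) (imagUnit_ne_zero L) (imagUnit_mul_self L)
          (realDiagonal_isSymm L (dD L e dV hdV dW hdW) (dD_conj L e dV hdV dW hdW)) (isSymm_TW (Fp L) a')
          (isUnit_det_realDiagonal L (dD L e dV hdV dW hdW) (dD_conj L e dV hdV dW hdW) (dD_ne_zero L e dV hdV dW hdW hdV0 hdW0))
          (isUnit_det_TW (Fp L) a') (realDiagonal_map L (dD L e dV hdV dW hdW) (dD_conj L e dV hdV dW hdW)).symm (JW_eq (Fp L) L a') e₁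
          (chiSplittingLine L e₁ (dD L e dV hdV dW hdW) (dD_conj L e dV hdV dW hdW) (dD_ne_zero L e dV hdV dW hdW hdV0 hdW0)
            (toHeckeCharacter L lam) (isUnitary_toHeckeCharacter L lam)
            ((isOscillatorChar_toHeckeCharacter_iff lam).mpr hlam) (TW (Fp L) a')
            (isUnit_det_TW (Fp L) a') (JW (Fp L) L a') (JW_eq (Fp L) L a'))
          (proj_chiSplittingLine_eq_toSp L e dV hdV dW hdW e₁ hdV0 hdW0 lam hlam a')
          (⟨expGL (t • X), expGL_smul_mem_arch (Matrix.diagonal (dD L e dV hdV dW hdW)) (archSkew_diagonal_of_hermD L e dV hdV dW hdW hX) t⟩, 1)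
          Ψ) :=
  (continuous_archWeilRep_apply_dD L e dV hdV dW hdW e₁ hdV0 hdW0 lam hlam a' Ψ).comp
    ((Continuous.subtype_mk (continuous_expGL_smul X) fun t =>
        expGL_smul_mem_arch (Matrix.diagonal (dD L e dV hdV dW hdW)) (archSkew_diagonal_of_hermD L e dV hdV dW hdW hX) t).prodMk
      continuous_const)

/-- the same along ANY continuous curve `γ : ℝ → H_∞ × U(⟨a′⟩)_∞` (e.g. left translates `t ↦ u₀ · (exp tX, 1)`).
[cite: Folland1989, §4.2, the Schur remark p. 156] [cite: Weil1964, Chap. III n° 39 p. 189] -/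
theorem continuous_archWeilRep_dD_comp
    {γ : ℝ → ↥(UnitaryGroup.arch (Fp L) L (IsCMField.complexConj L) (n + n) (Matrix.diagonal (dD L e dV hdV dW hdW))) ×
      ↥(UnitaryGroup.arch (Fp L) L (IsCMField.complexConj L) 1 (JW (Fp L) L a'))}
    (hγ : Continuous γ) (Ψ : 𝓢((Fin n'' → mixedSpace (Fp L)), ℂ)) :
    Continuous fun t : ℝ =>
      (archWeilRep (Fp L) L (IsCMField.complexConj L) (n + n) 1 (Matrix.diagonal (dD L e dV hdV dW hdW)) (JW (Fp L) L a')
          (complexConj_imagUnit L) (imagUnit_ne_zero L) (imagUnit_mul_self L)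
          (realDiagonal_isSymm L (dD L e dV hdV dW hdW) (dD_conj L e dV hdV dW hdW)) (isSymm_TW (Fp L) a')
          (isUnit_det_realDiagonal L (dD L e dV hdV dW hdW) (dD_conj L e dV hdV dW hdW) (dD_ne_zero L e dV hdV dW hdW hdV0 hdW0))
          (isUnit_det_TW (Fp L) a') (realDiagonal_map L (dD L e dV hdV dW hdW) (dD_conj L e dV hdV dW hdW)).symm (JW_eq (Fp L) L a') e₁
          (chiSplittingLine L e₁ (dD L e dV hdV dW hdW) (dD_conj L e dV hdV dW hdW) (dD_ne_zero L e dV hdV dW hdW hdV0 hdW0)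
            (toHeckeCharacter L lam) (isUnitary_toHeckeCharacter L lam)
            ((isOscillatorChar_toHeckeCharacter_iff lam).mpr hlam) (TW (Fp L) a')
            (isUnit_det_TW (Fp L) a') (JW (Fp L) L a') (JW_eq (Fp L) L a'))
          (proj_chiSplittingLine_eq_toSp L e dV hdV dW hdW e₁ hdV0 hdW0 lam hlam a')
          (γ t) Ψ) :=
  (continuous_archWeilRep_apply_dD L e dV hdV dW hdW e₁ hdV0 hdW0 lam hlam a' Ψ).comp hγ

end Doubled

end Summit.HodgeConjecture.HodgeConjecture.Cruxes.HLiu418.K2LiuArchWeilOrbitContinuous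

end
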